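import Literature.MathematicalPhysics.QuantumFieldTheory.Balaban1983to89.B9Thm312Whole

/-!
# `Balaban1983to89.B9Thm312WholeIdentitiesSplit` — [B9] Theorems 3.12–3.13 (pp. 420–426): the Sect.-D identity schema
# `B9Thm312Whole.Identities` SPLIT into its definitional ∕ resolvent part (ten fields) and the (3.124) ∕ p. 425 constraint algebra
# (three fields), so that the two parts can be displayed — and discharged — separately

T. Bałaban, *Propagators for lattice gauge theories in a background field*, Commun. Math. Phys. **99** (1985) 389–434
[`Balaban1985BackgroundPropagators`, "B9"].

statement-level skeleton of published theorems with citation tags; proofs where landed; nothing here is a claim about the Yang–Mills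
mass gap

THE PRINTED LOCUS (verbatim, held text `paper:balaban1985-cmp99-background-propagators`).  p. 420: *"We will prove that the second
term in the last line vanishes. More exactly we will prove the identities RD\*GQ\* = 0, hence QGDR = 0. (3.124) The proof is similar to
the proof of the corresponding identities (2.34) in [4]. … In the second equality we have used (3.115) and the condition Q′λ = 0"*;
p. 425: *"Verifying the above properties we need to know only the identities (3.124) and RD\*G₁DR = R"*.

THE POINT.  The rows-20–21 leaves of this lineage display `B9Thm312Whole.Identities 𝔬 U` — thirteen fields — as one conjunct of the
model binder (n06-d's `hmodel12`).  At the instance of record ten of them are definitional ∕ resolvent identities of def-Y's letters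
(G₀Δ_a = I, (Δ_a − Δ′_π)G = I, (Δ_a − Δ′_π − Δ⁽²⁾_π)G₁ = I, (3.126), (3.129), (3.153), (QG₁Q\*)(QG₁Q\*)⁻¹ = I, the adjointness of Q, Q\* and
D, D\*, the symmetry of R — node00-def-Y's pin table, memo `IDENTITIES-AT-LETTERS.md` §1–§2, to be discharged in its `Node00/OpsYSectDCoords`),
while the three fields of the (3.124) ∕ p. 425 constraint algebra — QG₁DR = 0, RD\*G₁Q\* = 0, RD\*G₁DR = R, which print derives from the
gauge-mode identity (3.115) of the covariant averaging — are NOT dischargeable at that instance (def-Y's located gap O5: the typed reading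
of Q(U) is the flat [4]-(2.20) kernel with one transporter per bond, for which *"λ ∈ N(Q′(U)) ⇒ Q(U)D_Uλ = 0"* fails at curved U; numerical
witness kit j284516; it holds at U = 1).  THIS FILE splits the schema so that the certificate can display the two parts separately —
`IdentitiesDef` (the ten, dischargeable) and `Ids3124` (the three, displayed and worded as located) — and proves the split is exact
(`identities_iff_def_and_3124`).  Field names and statements are those of `B9Thm312Whole.Identities`, verbatim.  Nothing new is
asserted.  Repair R1 of def-Y's menu, WORD of this seat 2026-08-27.

HONEST SCOPE.  Pure bookkeeping (an `↔`); COUNT-NEUTRAL; N06 is NOT discharged; one finite lattice at a time; nothing continuum, nothing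
about the mass gap.  Cell `pub-ymgap` (HUMAN RULING D-0062), Track A node N06 [B9], N06-ASSIGNMENT v1 rows 20–21 (bundle F7), seat
`pub-ymgap-dag-n06-l` (g11), 2026-08-27.
-/

namespace Literature.MathematicalPhysics.QuantumFieldTheory.Balaban1983to89.B9Thm312WholeIdentitiesSplit

open Literature.MathematicalPhysics.QuantumFieldTheory.Balaban1983to89
open B9Thm312Whole

noncomputable section

variable {g : B9.Geometry} {B : B9.Backgrounds} {X Y Z W : Type}
variable [Fintype X] [Fintype Z] [Fintype W]

/-- **THE DEFINITIONAL ∕ RESOLVENT PART OF THE SECT.-D IDENTITIES AT U** (ten fields of `B9Thm312Whole.Identities`, verbatim): G₀Δ_a = I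
(p. 421); (Δ_a − Δ′_π)G = I ((3.120), (3.122)); (Δ_a − Δ′_π − Δ⁽²⁾_π)G₁ = I ((3.128), (3.134)); H = GQ\*(QGQ\*)⁻¹ ((3.126)); H₁ = G₁Q\*(QG₁Q\*)⁻¹
((3.129)); 𝔊 = G₁𝔓\* ((3.153)); (QG₁Q\*)(QG₁Q\*)⁻¹ = I; Q\* adjoint to Q, D\* to D, R symmetric.  A HYPOTHESIS SCHEMA (nothing asserted); at the
instance of record these are identities of the pinned letters (node00-def-Y's pin table).
[cite: Balaban1985BackgroundPropagators, (3.120)–(3.130) pp.419–421 + (3.147) p.425 + (3.152)–(3.153) p.426] -/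
structure IdentitiesDef (𝔬 : Ops g B X Y Z W) (U : B.Cfg) : Prop where
  invG0' : 𝔬.G0 U * 𝔬.S0 U = 1
  invG : (𝔬.S0 U - 𝔬.Tpi U) * 𝔬.G U = 1
  invG1 : (𝔬.S0 U - (𝔬.Tpi U + 𝔬.T2 U)) * 𝔬.G1 U = 1
  eq126 : 𝔬.Hm U = 𝔬.G U ∘ₗ 𝔬.Qstar U ∘ₗ 𝔬.C U
  eq129 : 𝔬.H1m U = 𝔬.G1 U ∘ₗ 𝔬.Qstar U ∘ₗ 𝔬.C1 U
  eq153 : 𝔬.GG U = 𝔬.G1 U ∘ₗ frakPstar 𝔬 U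
  c1_inv : 𝔬.Q U ∘ₗ 𝔬.G1 U ∘ₗ 𝔬.Qstar U ∘ₗ 𝔬.C1 U = LinearMap.id
  adjQ : ∀ (f : X → ℝ) (b : Z → ℝ), 𝔬.Q U f ⬝ᵥ b = f ⬝ᵥ 𝔬.Qstar U b
  adjDv : ∀ (s : W → ℝ) (f : X → ℝ), 𝔬.Dv U s ⬝ᵥ f = s ⬝ᵥ 𝔬.Dvstar U f
  symmR : ∀ s t : W → ℝ, 𝔬.R U s ⬝ᵥ t = s ⬝ᵥ 𝔬.R U t

omit [Fintype X] [Fintype Z] [Fintype W] in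
/-- **THE (3.124) ∕ p. 425 CONSTRAINT ALGEBRA AT U** (three fields of `B9Thm312Whole.Identities`, verbatim): QG₁DR = 0 and RD\*G₁Q\* = 0 — (3.124)
with G₁ for G (p. 425: *"we need to know only the identities (3.124) and RD\*G₁DR = R"*) — and RD\*G₁DR = R.  Print derives them from the
gauge-mode identity (3.115) of the covariant averaging operations.  A HYPOTHESIS SCHEMA (nothing asserted); LOCATED (node00-def-Y O5,
2026-08-27): NOT dischargeable at the instance of record, whose typed averaging Q(U) is the flat [4]-(2.20) kernel (the identity holds at
U = 1) — displayed as such by the consumers. [cite: Balaban1985BackgroundPropagators, (3.124) p.420 + (3.115) p.418 + (3.147) p.425] -/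
structure Ids3124 (𝔬 : Ops g B X Y Z W) (U : B.Cfg) : Prop where
  h124Q : 𝔬.Q U ∘ₗ 𝔬.G1 U ∘ₗ 𝔬.Dv U ∘ₗ 𝔬.R U = 0
  h124R : 𝔬.R U ∘ₗ 𝔬.Dvstar U ∘ₗ 𝔬.G1 U ∘ₗ 𝔬.Qstar U = 0
  hR : 𝔬.R U ∘ₗ 𝔬.Dvstar U ∘ₗ 𝔬.G1 U ∘ₗ 𝔬.Dv U ∘ₗ 𝔬.R U = 𝔬.R U

/-- **THE SPLIT, ASSEMBLED**: the definitional part and the (3.124) part together are the schema `Identities` the Sect.-D leaves consume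
(the shape of the fifth conjunct of n06-d's `hmodel12`). [cite: Balaban1985BackgroundPropagators, (3.120)–(3.130) pp.419–421 + (3.124) p.420 + (3.147) p.425 + (3.153) p.426] -/
theorem identities_of_def_3124 {𝔬 : Ops g B X Y Z W} {U : B.Cfg} (hD : IdentitiesDef 𝔬 U) (h3 : Ids3124 𝔬 U) :
    Identities 𝔬 U where
  invG0' := hD.invG0'
  invG := hD.invG
  invG1 := hD.invG1
  eq126 := hD.eq126
  eq129 := hD.eq129
  eq153 := hD.eq153
  c1_inv := hD.c1_inv
  h124Q := h3.h124Q
  h124R := h3.h124R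
  hR := h3.hR
  adjQ := hD.adjQ
  adjDv := hD.adjDv
  symmR := hD.symmR

/-- The definitional part of `Identities`. [cite: Balaban1985BackgroundPropagators, (3.120)–(3.130) pp.419–421 + (3.153) p.426 (bookkeeping)] -/
theorem identitiesDef_of_identities {𝔬 : Ops g B X Y Z W} {U : B.Cfg} (h : Identities 𝔬 U) : IdentitiesDef 𝔬 U where
  invG0' := h.invG0'
  invG := h.invG
  invG1 := h.invG1
  eq126 := h.eq126
  eq129 := h.eq129
  eq153 := h.eq153
  c1_inv := h.c1_inv
  adjQ := h.adjQ
  adjDv := h.adjDv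
  symmR := h.symmR

/-- The (3.124) part of `Identities`. [cite: Balaban1985BackgroundPropagators, (3.124) p.420 + (3.147) p.425 (bookkeeping)] -/
theorem ids3124_of_identities {𝔬 : Ops g B X Y Z W} {U : B.Cfg} (h : Identities 𝔬 U) : Ids3124 𝔬 U where
  h124Q := h.h124Q
  h124R := h.h124R
  hR := h.hR

/-- **THE SPLIT IS EXACT**: `Identities 𝔬 U ↔ IdentitiesDef 𝔬 U ∧ Ids3124 𝔬 U`. [cite: Balaban1985BackgroundPropagators, (3.120)–(3.130) pp.419–421 + (3.124) p.420 + (3.147) p.425 + (3.153) p.426 (bookkeeping)] -/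
theorem identities_iff_def_and_3124 (𝔬 : Ops g B X Y Z W) (U : B.Cfg) :
    Identities 𝔬 U ↔ IdentitiesDef 𝔬 U ∧ Ids3124 𝔬 U :=
  ⟨fun h => ⟨identitiesDef_of_identities h, ids3124_of_identities h⟩, fun h => identities_of_def_3124 h.1 h.2⟩

end

end Literature.MathematicalPhysics.QuantumFieldTheory.Balaban1983to89.B9Thm312WholeIdentitiesSplit
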